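import Mathlib
import Summits.Ventures.PercRepro2.SwOutMixedPartSw
import Summits.Ventures.PercRepro2.SwOutSevThm

/-!
# Row (SW) on every graph with a several-arms junction (blind cell PercRepro2, night-4 g22,
2026-08-27; proofs/NIGHT4-G22.md §6)

Theorem A_sev (`rigidOK_of_mixedJunctionR`) makes a region with a several-arms junction a base
region of the series reduction (`reducible_of_mixedJunctionR`); with `U = {l}ᶜ` this gives rows
2′SW-ALL and (SW) on every graph in which some vertex `u ≠ l, h` has every neighbour adjacent to
`h` or a dropped vertex with its h-piece — the mixed single junction of Theorem A_mix being the
case of one dropped vertex (with (e)), the (H1) junction of Theorem A the case of pure arms only.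
-/

namespace Summit.Ventures.PercRepro2

namespace MixedArms

open Hull LocRows BigBlock

variable {V : Type*} {E : Type*} [Fintype E] [DecidableEq E]

open scoped Classical

variable {ends : E → Sym2 V} {ρ : Type*} [Fintype ρ] {U : Set V} {l h o u : V} {p : ρ → V}

/-- A region with a several-arms junction is a base region of the series reduction. -/
theorem reducible_of_mixedJunctionR (hj : MixedJunctionR ends U h u p o) (hl : l ∉ U)
    (ho : ∀ r, o ∉ compU ends U h u (p r)) : Reducible l h o ends U :=
  Reducible.base ends U fun ξ => rigidOK_of_mixedJunctionR (ξ := ξ) hj hl ho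

/-- **Row 2′SW-ALL on every graph with a several-arms junction** in `{l}ᶜ`. -/
theorem swAll_of_mixedJunctionR (hlh : l ≠ h) (hj : MixedJunctionR ends ({l}ᶜ) h u p o)
    (ho : ∀ r, o ∉ compU ends ({l}ᶜ) h u (p r)) : SwAll ends l h o :=
  swAll_of_reducible l h o hlh (reducible_of_mixedJunctionR hj (by simp) ho)

/-- **Row (SW) on every graph with a several-arms junction** (see `swAll_of_mixedJunctionR`). -/
theorem sw_of_mixedJunctionR (hlh : l ≠ h) (hj : MixedJunctionR ends ({l}ᶜ) h u p o)
    (ho : ∀ r, o ∉ compU ends ({l}ᶜ) h u (p r)) : Sw ends l h o :=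
  sw_of_swAll ends (swAll_of_mixedJunctionR hlh hj ho)

end MixedArms

end Summit.Ventures.PercRepro2
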